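import Literature.Computability.AlgebraicComplexity.ApproxDecompositionCertificate
import Literature.Computability.AlgebraicComplexity.AsymptoticRankBorderRank
import Literature.Computability.AlgebraicComplexity.BorderRankRestriction
import Literature.Computability.AlgebraicComplexity.KroneckerRank
import Literature.Computability.AlgebraicComplexity.PartialMatrixMultiplicationRestriction
import HarnessLib

/-!
# `bR(T(U₃)) ≤ 9 < 10 = R(T(U₃))`: Bini's approximate algorithm lives inside the `3 × 3` upper triangular matrices

`T(U₃) = ⟨3,3,3⟩_{U₃,U₃}` is the partial matrix multiplication "upper triangular times upper
triangular" of order `3` (`U₃ = {(i,j) : i ≤ j}`), i.e. the structure tensor of the algebra `T₃(K)`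
of upper triangular `3 × 3` matrices, padded by zero slices to the format `(3²)³`
(`partialMatMulTensor K 3 3 3 U₃ U₃`; this is `triangularTensor K 3` of `SoloInformedTriangularDoor`,
definitionally).  Its support consists of the `10` chains `x_{ij} y_{jl} z_{il}`, `i ≤ j ≤ l`, and
over an algebraically closed field its RANK is exactly `10` — the trivial algorithm is optimal for
exact computation in `T₃(K)` [BurgisserClausenShokrollahi1997, Ex. 17.24*]; its border rank is
`≥ 3·(3·3+1)/4`, i.e. `≥ 8` [BurgisserClausenShokrollahi1997, Cor. (19.14)].

## What is proved (kernel-checked integer certificates, `decide +kernel`)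
* `triThree_check_nine`, `algBorderRank_triThree_le_nine`,
  `algBorderRank_partialMatMul_upper_three_le_nine`: **`bR(T(U₃)) ≤ 9` over every field.**
  THE MECHANISM: the six chains through the `2 × 2` blocks `X[{1,2}, {2,3}]` (all four entries lie in
  `U₃`) and `Y[{2,3}, {2,3}]` (upper triangular: `y₃₂ = 0`) form the product of a FULL `2 × 2` matrix
  with a `2 × 2` matrix having one zero entry — the Bini–Capovani–Lotti–Romani partial matrix
  multiplication of 1979, of border rank `5` [BurgisserClausenShokrollahi1997, §15.2, (15.6) ff.:
  `F₁(ε)`, five products, order `1`]; the remaining four chains `x₁₁(y₁₁z₁₁ + y₁₂z₁₂ + y₁₃z₁₃)`,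
  `x₃₃y₃₃z₃₃` are four more products.  `5 + 4 = 9`: an integer certificate with entries in `{0, ±1}`,
  order `1`, multiplier `1`.
* `triThree_check_ten_rank`, `tensorRank_partialMatMul_upper_three_le_ten`: `R(T(U₃)) ≤ 10` over every
  field (the ten chains; equality over algebraically closed fields is BCS Ex. 17.24*, not formalised).
* `asymptoticRank_partialMatMul_upper_three_le_nine`: **`R̃(T(U₃)) ≤ 9`** over every field
  (`R̃ ≤ bR`, `asymptoticRank_le_of_algBorderRank_le`).

## Why it is recorded here
(i) Together with Ex. 17.24* and Cor. (19.14) of [BurgisserClausenShokrollahi1997]: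
`8 ≤ bR(T₃(ℂ)) ≤ 9 < 10 = R(T₃(ℂ))` — approximate algorithms beat the optimal exact one already for
the `6`-dimensional algebra `T₃`, while for `T₂` they do not (`bR(T₂) = R(T₂) = 4`,
`SoloInformedTTwoSquare`) but do at its Kronecker square (`bR(T₂ ⊠ T₂) ≤ 14 < 16`,
`SoloInformedTTwoSquareBini`).  Which of `8, 9` is the border rank of `T₃(ℂ)` is left open here
(numerically, rank-`8` alternating least squares for `T(U₃)` plateaus at residual² `= 1/10` of
`‖T(U₃)‖²` from every start, rank `9` shows the border signature: evidence for `9`).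
(ii) For the triangular doors of `SoloInformedTriangularDoor` (`f(U₃)^{ω/3} = 10^{ω/3} ≤ R̃(T(U₃))`,
`ω = 2 ⟺ ∀ k, R̃(T(U_k)) ≤ k²`): the rung-`3` window becomes `6 ≤ R̃(T(U₃)) ≤ 9`, sharper than the
Peirce-split bound `R̃(T(U₃)) ≤ R̃(T₂) + 6 ∈ [9, 9.75)` of `SoloInformedTriangularThreeUpper`, which can
never go below `9` since `R̃(T₂) ≥ 3`.  `R̃(T(U₃)) ≤ 6` would give `ω < 2.335`; the record `ω < 2.3713`
needs `R̃(T(U₃)) < 6.17`.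
(iii) The same packing works in every `U_k`, `k ≥ 3`: disjoint BCLR blocks inside the chain set give
`bR(T(U_k)) ≤ binom(k+2,3) − (number of packed blocks)` (e.g. `bR(T(U₄)) ≤ 18 < 20`; not formalised).

## References
* [BurgisserClausenShokrollahi1997] P. Bürgisser, M. Clausen, M. A. Shokrollahi, *Algebraic
  Complexity Theory*, Springer 1997: §15.2 ((15.6) ff., the BCLR algorithm `F₁(ε)`), §15.9 (partial
  matrix multiplication), Ex. 17.24* (`R(T₃) = 10`), Cor. (19.14) (`bR(T_m) ≥ m(3m+1)/4`).
* [Blaser2013] M. Bläser, *Fast Matrix Multiplication*, ToC Graduate Surveys 5 (2013), Def. 6.1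
  (order-`h` approximate decompositions; the certificate format `ApproxCert.check`).
-/

namespace Summit.MatrixMultiplication.MatrixMultiplication.Theorems

open Literature.Computability.AlgebraicComplexity

/-- **`T(U₃)` as an integer tensor of format `9 × 9 × 9`**: position `(i,j) ∈ [3]²` has flat index
`3i + j` (`finProdFinEquiv`, row-major, `0`-based); slot `1` = output position `(i,l)`, slot `2` =
`X`-entry `(i,j)`, slot `3` = `Y`-entry `(j,l)` (the slot order of `partialMatMulTensor`); the ten
entries are the chains `i ≤ j ≤ l`. [cite: BurgisserClausenShokrollahi1997, §15.9] -/
def triThreeInt : Fin 9 → Fin 9 → Fin 9 → ℤ :=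
  ApproxCert.ofEntries 9 9 9
    [((0, 0, 0), 1), ((1, 0, 1), 1), ((1, 1, 4), 1), ((2, 0, 2), 1), ((2, 1, 5), 1),
     ((2, 2, 8), 1), ((4, 4, 4), 1), ((5, 4, 5), 1), ((5, 5, 8), 1), ((8, 8, 8), 1)]

/-- **The `9`-term integer approximate decomposition of `T(U₃)` of order `1`** (BCLR inside `U₃`).
In `1`-based matrix coordinates (`z` = output = slot 1, `x` = slot 2, `y` = slot 3) the nine products
`z ⊗ x ⊗ y` are
`z₂₃ ⊗ (x₂₂ + εx₂₃) ⊗ (y₃₃ + εy₂₃)`, `(z₁₃ + εz₁₂) ⊗ x₁₂ ⊗ (y₂₂ + εy₂₃)`,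
`−(z₁₃ + z₂₃ + εz₂₂) ⊗ x₂₂ ⊗ y₃₃`, `−z₁₃ ⊗ (x₁₂ + x₂₂ + εx₁₃) ⊗ y₂₂`,
`(z₁₃ + εz₂₂) ⊗ (x₂₂ + εx₁₃) ⊗ (y₃₃ + y₂₂)` — BCS's `F₁(ε)` under the dictionary
`X₁₁ = y₂₃, X₁₂ = y₃₃, X₂₁ = y₂₂, X₂₂ = y₃₂ = 0; Y₁₁ = x₁₂, Y₁₂ = x₂₂, Y₂₁ = x₁₃, Y₂₂ = x₂₃;
Z₁₁ = z₁₃, Z₂₁ = z₂₃, Z₁₂ = z₁₂, Z₂₂ = z₂₂` (transpose the BCLR product and swap its two rows) — and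
`εz₁₁ ⊗ x₁₁ ⊗ y₁₁`, `εz₁₂ ⊗ x₁₁ ⊗ y₁₂`, `εz₁₃ ⊗ x₁₁ ⊗ y₁₃`, `εz₃₃ ⊗ x₃₃ ⊗ y₃₃`; their sum is
`ε·T(U₃) + O(ε²)`. [cite: BurgisserClausenShokrollahi1997, §15.2] -/
theorem triThree_check_nine :
    ApproxCert.check 9 9 9 9 1 1 triThreeInt
      (![![[], [], [], [], [], [1], [], [], []],
        ![[], [0, 1], [1], [], [], [], [], [], []],
        ![[], [], [-1], [], [0, -1], [-1], [], [], []],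
        ![[], [], [-1], [], [], [], [], [], []],
        ![[], [], [1], [], [0, 1], [], [], [], []],
        ![[0, 1], [], [], [], [], [], [], [], []],
        ![[], [0, 1], [], [], [], [], [], [], []],
        ![[], [], [0, 1], [], [], [], [], [], []],
        ![[], [], [], [], [], [], [], [], [0, 1]]])
      (![![[], [], [], [], [1], [0, 1], [], [], []],
        ![[], [1], [], [], [], [], [], [], []],
        ![[], [], [], [], [1], [], [], [], []],
        ![[], [1], [0, 1], [], [1], [], [], [], []],
        ![[], [], [0, 1], [], [1], [], [], [], []],
        ![[1], [], [], [], [], [], [], [], []],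
        ![[1], [], [], [], [], [], [], [], []],
        ![[1], [], [], [], [], [], [], [], []],
        ![[], [], [], [], [], [], [], [], [1]]])
      (![![[], [], [], [], [], [0, 1], [], [], [1]],
        ![[], [], [], [], [1], [0, 1], [], [], []],
        ![[], [], [], [], [], [], [], [], [1]],
        ![[], [], [], [], [1], [], [], [], []],
        ![[], [], [], [], [1], [], [], [], [1]],
        ![[1], [], [], [], [], [], [], [], []],
        ![[], [1], [], [], [], [], [], [], []],
        ![[], [], [1], [], [], [], [], [], []],
        ![[], [], [], [], [], [], [], [], [1]]]) = true := by
  decide +kernel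

/-- **`bR(T(U₃)) ≤ 9`** over every field, for the explicit integer tensor `triThreeInt`.
[cite: BurgisserClausenShokrollahi1997, §15.2] -/
theorem algBorderRank_triThree_le_nine (K : Type*) [Field K] :
    algBorderRank (fun i j l => (triThreeInt i j l : K)) ≤ 9 :=
  ApproxCert.algBorderRank_le_of_check_one K triThree_check_nine

/-- The ten chains as an order-`0` certificate: `R(T(U₃)) ≤ 10` (the trivial algorithm).
[cite: BurgisserClausenShokrollahi1997, Ex. 17.24] -/
theorem triThree_check_ten_rank :
    ApproxCert.check 9 9 9 10 0 1 triThreeInt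
      (![![[1], [], [], [], [], [], [], [], []],
        ![[], [1], [], [], [], [], [], [], []],
        ![[], [1], [], [], [], [], [], [], []],
        ![[], [], [1], [], [], [], [], [], []],
        ![[], [], [1], [], [], [], [], [], []],
        ![[], [], [1], [], [], [], [], [], []],
        ![[], [], [], [], [1], [], [], [], []],
        ![[], [], [], [], [], [1], [], [], []],
        ![[], [], [], [], [], [1], [], [], []],
        ![[], [], [], [], [], [], [], [], [1]]])
      (![![[1], [], [], [], [], [], [], [], []],
        ![[1], [], [], [], [], [], [], [], []],
        ![[], [1], [], [], [], [], [], [], []],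
        ![[1], [], [], [], [], [], [], [], []],
        ![[], [1], [], [], [], [], [], [], []],
        ![[], [], [1], [], [], [], [], [], []],
        ![[], [], [], [], [1], [], [], [], []],
        ![[], [], [], [], [1], [], [], [], []],
        ![[], [], [], [], [], [1], [], [], []],
        ![[], [], [], [], [], [], [], [], [1]]])
      (![![[1], [], [], [], [], [], [], [], []],
        ![[], [1], [], [], [], [], [], [], []],
        ![[], [], [], [], [1], [], [], [], []],
        ![[], [], [1], [], [], [], [], [], []],
        ![[], [], [], [], [], [1], [], [], []],
        ![[], [], [], [], [], [], [], [], [1]],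
        ![[], [], [], [], [1], [], [], [], []],
        ![[], [], [], [], [], [1], [], [], []],
        ![[], [], [], [], [], [], [], [], [1]],
        ![[], [], [], [], [], [], [], [], [1]]]) = true := by
  decide +kernel

/-- `R(T(U₃)) ≤ 10` over every field, for the explicit integer tensor `triThreeInt`.
[cite: BurgisserClausenShokrollahi1997, Ex. 17.24] -/
theorem tensorRank_triThree_le_ten (K : Type*) [Field K] :
    tensorRank (fun i j l => (triThreeInt i j l : K)) ≤ 10 :=
  ApproxCert.tensorRank_le_of_check_one K triThree_check_ten_rank

/-! ## Identification with the padded partial matrix multiplication tensor `⟨3,3,3⟩_{U₃,U₃}` -/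

/-- Entrywise, at the integer level: `triThreeInt (3i+l) (3i'+j) (3j'+l')` is the indicator of
"`(i',j)` and `(j',l')` upper triangular and `i = i'`, `j = j'`, `l = l'`". [folklore] -/
theorem triThreeInt_finProdFinEquiv :
    ∀ a b c : Fin 3 × Fin 3, triThreeInt (finProdFinEquiv a) (finProdFinEquiv b) (finProdFinEquiv c) =
      if (b.1 ≤ b.2 ∧ c.1 ≤ c.2) ∧ (a.1 = b.1 ∧ b.2 = c.1 ∧ a.2 = c.2) then 1 else 0 := by
  decide +kernel

/-- **`T(U₃) = ⟨3,3,3⟩_{U₃,U₃}` is the relabelling of `triThreeInt` by `finProdFinEquiv`** on each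
slot. [cite: BurgisserClausenShokrollahi1997, §15.9] -/
theorem partialMatMulTensor_upper_three_eq (K : Type*) [Field K] :
    partialMatMulTensor K 3 3 3 (Finset.univ.filter fun p : Fin 3 × Fin 3 => p.1 ≤ p.2)
        (Finset.univ.filter fun p : Fin 3 × Fin 3 => p.1 ≤ p.2) =
      fun a b c => (triThreeInt (finProdFinEquiv a) (finProdFinEquiv b) (finProdFinEquiv c) : K) := by
  funext a b c
  rw [partialMatMulTensor_apply, triThreeInt_finProdFinEquiv]
  simp only [Finset.mem_filter, Finset.mem_univ, true_and]
  split_ifs <;> simp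

/-- **`bR(T(U₃)) ≤ 9` over every field**: the border rank of "upper triangular times upper
triangular" of order `3` (the structure tensor of `T₃(K)`, padded) is at most `9`, one less than its
rank `10` over algebraically closed `K` (BCS Ex. 17.24*). [cite: BurgisserClausenShokrollahi1997, §15.2] -/
theorem algBorderRank_partialMatMul_upper_three_le_nine (K : Type*) [Field K] :
    algBorderRank (partialMatMulTensor K 3 3 3 (Finset.univ.filter fun p : Fin 3 × Fin 3 => p.1 ≤ p.2)
        (Finset.univ.filter fun p : Fin 3 × Fin 3 => p.1 ≤ p.2)) ≤ 9 := by
  rw [partialMatMulTensor_upper_three_eq]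
  have h := algBorderRank_reindex (ι' := Fin 3 × Fin 3) (κ' := Fin 3 × Fin 3) (μ' := Fin 3 × Fin 3)
    finProdFinEquiv finProdFinEquiv finProdFinEquiv (fun i j l => (triThreeInt i j l : K))
  exact h.trans_le (algBorderRank_triThree_le_nine K)

/-- `R(T(U₃)) ≤ 10` over every field, padded form. [cite: BurgisserClausenShokrollahi1997, Ex. 17.24] -/
theorem tensorRank_partialMatMul_upper_three_le_ten (K : Type*) [Field K] :
    tensorRank (partialMatMulTensor K 3 3 3 (Finset.univ.filter fun p : Fin 3 × Fin 3 => p.1 ≤ p.2)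
        (Finset.univ.filter fun p : Fin 3 × Fin 3 => p.1 ≤ p.2)) ≤ 10 := by
  rw [partialMatMulTensor_upper_three_eq]
  have h := tensorRank_reindex (ι' := Fin 3 × Fin 3) (κ' := Fin 3 × Fin 3) (μ' := Fin 3 × Fin 3)
    finProdFinEquiv finProdFinEquiv finProdFinEquiv (fun i j l => (triThreeInt i j l : K))
  exact h.trans_le (tensorRank_triThree_le_ten K)

/-- **`R̃(T(U₃)) ≤ 9` over every field** (`R̃ ≤ bR`): the rung-`3` triangular door quantity of
`SoloInformedTriangularDoor` satisfies `6 ≤ R̃(T(U₃)) ≤ 9` (the `6` = `|U₃|` is the flattening bound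
there); `R̃(T(U₃)) ≤ 6` would give `ω < 2.335`. [cite: BurgisserClausenShokrollahi1997, Lemma (15.27)] -/
theorem asymptoticRank_partialMatMul_upper_three_le_nine (K : Type*) [Field K] :
    asymptoticRank (partialMatMulTensor K 3 3 3 (Finset.univ.filter fun p : Fin 3 × Fin 3 => p.1 ≤ p.2)
        (Finset.univ.filter fun p : Fin 3 × Fin 3 => p.1 ≤ p.2)) ≤ 9 :=
  asymptoticRank_le_of_algBorderRank_le (algBorderRank_partialMatMul_upper_three_le_nine K)

end Summit.MatrixMultiplication.MatrixMultiplication.Theorems
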